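import Summits.Ventures.PercRepro.ProfilePointedCircuitClassesPairFive
import Summits.Ventures.PercRepro.ProfilePointedCircuitClassesInOutFive

/-!
# PercRepro — `InOutBottomFive` AT EVERY POINT OF A MATROID WITH A PARALLEL PAIR AVOIDING IT (p5, gen 50;
`proofs/P5-GM1.md` §75)

Let `#E = ρ(E) + 5`, `ρ(E) ≥ 7`, and let `x ∥ x'` be two distinct parallel non-loops with `e ∉ {x, x'}`.  Every
bi-independent set contains EXACTLY ONE of `x, x'` (an independent set contains at most one of two parallel points,
and so does the independent complement), so the bi-independent `k`-sets through `e` split as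
`in_k(e) = thru_k({x, e}) + thru_k({x', e})`, and each summand is a pointed count of a nullity-4 minor
(`thruCount_pair_eq_inCount_of_parallel`: `thru_k({x, e}) = in_{k−1}(e)` on `N ／ x' ∖ x`).  Hence
`in_5(e) = in_4^{N／x'∖x}(e) + in_4^{N／x∖x'}(e)` and, by complementation (`out_6(e) = in_{n−6}(e)`),
`out_6(e) = out_5^{N／x'∖x}(e) + out_5^{N／x∖x'}(e)`, and the claim `in_5(e) ≤ out_6(e)` is the nullity-4 theorem
`inOutBottomFour_holds` on the two minors (ten points and rank `6` at `n = 12`).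

Consequence for the twelve-point statement: `in_5(e) ≤ out_6(e)` at EVERY point of EVERY non-simple 12-point matroid
of rank 7 (a parallel pair containing `e` is the twin case `inCount_five_le_outCount_six_of_parallel`); together with
the coloop reductions, `InOutBottomFive` is needed only on SIMPLE coloop-free matroids.
-/

open scoped Matroid

namespace PercRepro.Cogirth

open Finset ThmH Skew Shadow Profile

variable {α : Type} [DecidableEq α] {N : Matroid α} [N.Finite]

section FiveParallelPair

/-- Parallelism is symmetric: `x' ∈ cl{x}` with `x, x'` non-loops gives `x ∈ cl{x'}`. -/
theorem mem_clF_singleton_of_parallel {x x' : α} (hx : x ∈ gr N) (hx' : x' ∈ gr N)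
    (hrx : rk N {x} = 1) (hrx' : rk N {x'} = 1) (hcl : x' ∈ clF N {x}) : x ∈ clF N {x'} := by
  have h1 : rk N (insert x' {x}) = rk N {x} := by
    rw [rk_insert_eq hx' (singleton_subset_iff.2 hx), if_pos hcl]
  have h2 : rk N (insert x {x'}) = rk N (insert x' {x}) := by rw [pair_comm]
  have h3 := rk_insert_eq hx (singleton_subset_iff.2 hx') (M := N)
  rw [h2, h1, hrx, hrx'] at h3
  by_contra hnot
  rw [if_neg hnot] at h3
  omega

/-- An independent set contains at most one of two distinct parallel points. -/
theorem not_mem_of_mem_of_rk_eq_card_of_parallel {x x' : α} (hx : x ∈ gr N) (hx' : x' ∈ gr N)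
    (hxx' : x ≠ x') (hrx : rk N {x} = 1) (hcl : x' ∈ clF N {x}) {W : Finset α}
    (hWi : rk N W = W.card) (hxW : x ∈ W) : x' ∉ W := by
  intro hx'W
  have hsub : ({x, x'} : Finset α) ⊆ W := insert_subset hxW (singleton_subset_iff.2 hx'W)
  have h1 := rk_eq_card_of_subset_of_rk_eq_card hsub hWi
  rw [card_pair hxx'] at h1
  have h2 : rk N ({x, x'} : Finset α) = 1 := by
    have e1 : ({x, x'} : Finset α) = insert x' {x} := pair_comm x x'
    rw [e1, rk_insert_eq hx' (singleton_subset_iff.2 hx), if_pos hcl, hrx]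
  omega

/-- **A bi-independent set contains exactly one of two parallel points**: at most one because it is independent,
at least one because its complement is independent. -/
theorem mem_or_mem_of_mem_biIndepSets_of_parallel {x x' : α} (hx : x ∈ gr N) (hx' : x' ∈ gr N)
    (hxx' : x ≠ x') (hrx : rk N {x} = 1) (hcl : x' ∈ clF N {x}) {k : ℕ} {W : Finset α}
    (hW : W ∈ biIndepSets N k) : (x ∈ W ∧ x' ∉ W) ∨ (x' ∈ W ∧ x ∉ W) := by
  rw [mem_biIndepSets] at hW
  obtain ⟨hWg, _, hWr, hWc⟩ := hW
  by_cases hxW : x ∈ W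
  · exact Or.inl ⟨hxW, not_mem_of_mem_of_rk_eq_card_of_parallel hx hx' hxx' hrx hcl hWr hxW⟩
  · right
    refine ⟨?_, hxW⟩
    by_contra hx'W
    have hxc : x ∈ gr N \ W := mem_sdiff.2 ⟨hx, hxW⟩
    exact not_mem_of_mem_of_rk_eq_card_of_parallel hx hx' hxx' hrx hcl hWc hxc (mem_sdiff.2 ⟨hx', hx'W⟩)

/-- **THE SPLIT OF THE POINTED COUNT ALONG A PARALLEL PAIR**: for `e ∉ {x, x'}`,
`in_k(e) = thru_k({x, e}) + thru_k({x', e})`. -/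
theorem inCount_eq_thruCount_add_thruCount_of_parallel {e x x' : α} (hx : x ∈ gr N) (hx' : x' ∈ gr N)
    (hxx' : x ≠ x') (hrx : rk N {x} = 1) (hcl : x' ∈ clF N {x}) (k : ℕ) :
    inCount N k e = thruCount N k {x, e} + thruCount N k {x', e} := by
  unfold inCount thruCount
  rw [← card_filter_add_card_filter_not (s := (biIndepSets N k).filter (fun X => e ∈ X)) (fun X => x ∈ X),
    filter_filter, filter_filter]
  congr 1
  · apply congrArg
    apply filter_congr
    intro W _
    rw [insert_subset_iff, singleton_subset_iff]
    tauto
  · apply congrArg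
    apply filter_congr
    intro W hW
    rw [insert_subset_iff, singleton_subset_iff]
    rcases mem_or_mem_of_mem_biIndepSets_of_parallel hx hx' hxx' hrx hcl hW with h | h
    · tauto
    · tauto

/-- **`InOutBottomFive` AT EVERY POINT AVOIDED BY A PARALLEL PAIR**: on `#E = ρ(E) + 5`, `ρ(E) ≥ 7`, if `x ∥ x'` are
distinct parallel non-loops and `e ∉ {x, x'}`, then `in_5(e) ≤ out_6(e)`.  Both sides split along the pair into
pointed counts of the nullity-4 minors `N ／ x' ∖ x` and `N ／ x ∖ x'` (`in_4(e)` resp. `out_5(e)` there), where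
`inOutBottomFour_holds` applies. -/
theorem inCount_five_le_outCount_six_of_parallel_pair (hn : (gr N).card = rk N (gr N) + 5)
    (hR : 7 ≤ rk N (gr N)) {e x x' : α} (he : e ∈ gr N) (hx : x ∈ gr N) (hx' : x' ∈ gr N)
    (hxx' : x ≠ x') (hex : e ≠ x) (hex' : e ≠ x') (hrx : rk N {x} = 1) (hrx' : rk N {x'} = 1)
    (hcl : x' ∈ clF N {x}) : inCount N 5 e ≤ outCount N 6 e := by
  have hcl' : x ∈ clF N {x'} := mem_clF_singleton_of_parallel hx hx' hrx hrx' hcl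
  -- the two minors
  have hmin : ∀ (s f : α), s ∈ gr N → f ∈ gr N → s ≠ f → e ≠ s → e ≠ f → rk N {s} = 1 → rk N {f} = 1 →
      f ∈ clF N {s} →
      thruCount N 5 {s, e} = inCount ((N ／ ({f} : Set α)) ＼ ({s} : Set α)) 4 e ∧
      thruCount N ((gr N).card - 6) {s, e} = outCount ((N ／ ({f} : Set α)) ＼ ({s} : Set α)) 5 e ∧
      inCount ((N ／ ({f} : Set α)) ＼ ({s} : Set α)) 4 e ≤
        outCount ((N ／ ({f} : Set α)) ＼ ({s} : Set α)) 5 e := by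
    intro s f hs hf hsf hes hef hrs hrf hfcl
    have hC : ({s} : Finset α) ⊆ gr N := singleton_subset_iff.2 hs
    have hxC : f ∉ ({s} : Finset α) := by rw [mem_singleton]; exact fun h => hsf h.symm
    have hrk : rk N {s} = ({s} : Finset α).card := by rw [hrs, card_singleton]
    have hfund : ∀ c ∈ ({s} : Finset α), f ∉ clF N (({s} : Finset α).erase c) := by
      intro c hc
      rw [mem_singleton] at hc
      rw [hc, erase_singleton]
      intro h0
      have h := rk_insert_eq hf (empty_subset (gr N)) (M := N)
      rw [insert_empty, if_pos h0] at h
      have h1 : rk N ∅ = 0 := Nat.le_zero.1 ((rk_le_card (M := N) ∅).trans (by rw [card_empty]))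
      omega
    obtain ⟨hgr₀, hcard₀, hrkg₀⟩ :=
      minor_facts_of_circuit hC hf hxC hrk hfcl hfund hrf (mem_singleton_self s)
    have he₀ : e ∈ gr ((N ／ ({f} : Set α)) ＼ ({s} : Set α)) := by
      rw [hgr₀]
      exact mem_erase.2 ⟨hes, mem_erase.2 ⟨hef, he⟩⟩
    have hn₀ : (gr ((N ／ ({f} : Set α)) ＼ ({s} : Set α))).card =
        rk ((N ／ ({f} : Set α)) ＼ ({s} : Set α)) (gr ((N ／ ({f} : Set α)) ＼ ({s} : Set α))) + 4 := by
      rw [hcard₀, hrkg₀]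
      omega
    have hR₀ : 6 ≤ rk ((N ／ ({f} : Set α)) ＼ ({s} : Set α)) (gr ((N ／ ({f} : Set α)) ＼ ({s} : Set α))) := by
      rw [hrkg₀]
      omega
    refine ⟨?_, ?_, inOutBottomFour_holds _ e he₀ hn₀ hR₀⟩
    · rw [thruCount_pair_eq_inCount_of_parallel hes.symm hsf hef hs hf hrs hrf hfcl (by norm_num)]
    · rw [thruCount_pair_eq_inCount_of_parallel hes.symm hsf hef hs hf hrs hrf hfcl (by omega)]
      have hsym := inCount_sub_eq_outCount (M := (N ／ ({f} : Set α)) ＼ ({s} : Set α)) (k := 5) he₀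
        (by rw [hcard₀]; omega)
      rw [hcard₀] at hsym
      have e2 : (gr N).card - 6 - 1 = (gr N).card - 2 - 5 := by omega
      rw [e2, hsym]
  obtain ⟨h1, h2, h3⟩ := hmin x x' hx hx' hxx' hex hex' hrx hrx' hcl
  obtain ⟨h1', h2', h3'⟩ := hmin x' x hx' hx hxx'.symm hex' hex hrx' hrx hcl'
  have hout : outCount N 6 e = inCount N ((gr N).card - 6) e :=
    (inCount_sub_eq_outCount (M := N) (k := 6) he (by omega)).symm
  rw [hout, inCount_eq_thruCount_add_thruCount_of_parallel hx hx' hxx' hrx hcl,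
    inCount_eq_thruCount_add_thruCount_of_parallel hx hx' hxx' hrx hcl, h1, h1', h2, h2']
  omega

/-- **THE TWELVE-POINT STATEMENT AT EVERY POINT OF A NON-SIMPLE MATROID**: on `#E = 12`, `ρ(E) = 7`, if `N` has two
distinct parallel non-loops `x, x'` (anywhere), then `in_5(e) ≤ out_6(e)` at every point `e`: a point of the pair by
the twin case (`inCount_five_le_outCount_six_of_parallel`), any other point by
`inCount_five_le_outCount_six_of_parallel_pair`. -/
theorem inCount_five_le_outCount_six_of_twelve_of_parallel_pair (hn : (gr N).card = 12)
    (hR : rk N (gr N) = 7) {x x' : α} (hx : x ∈ gr N) (hx' : x' ∈ gr N) (hxx' : x ≠ x')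
    (hrx : rk N {x} = 1) (hrx' : rk N {x'} = 1) (hcl : x' ∈ clF N {x}) {e : α} (he : e ∈ gr N) :
    inCount N 5 e ≤ outCount N 6 e := by
  have hn' : (gr N).card = rk N (gr N) + 5 := by omega
  have hR' : 7 ≤ rk N (gr N) := by omega
  by_cases hex : e = x
  · subst hex
    exact inCount_five_le_outCount_six_of_parallel hn' hR' hxx' hx hx' hrx hrx' hcl
  by_cases hex' : e = x'
  · subst hex'
    exact inCount_five_le_outCount_six_of_parallel hn' hR' hxx'.symm hx' hx hrx' hrx
      (mem_clF_singleton_of_parallel hx hx' hrx hrx' hcl)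
  exact inCount_five_le_outCount_six_of_parallel_pair hn' hR' he hx hx' hxx' hex hex' hrx hrx' hcl

end FiveParallelPair

end PercRepro.Cogirth
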